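/-
Copyright: internal research formalization. Source texts: G. Kempf, F. Knudsen, D. Mumford,
B. Saint-Donat, Toroidal Embeddings I (LNM 339, Springer 1973) [KempfEtAl1973], Ch. II §2
(Theorems 4*, 9*, 11* for conical polyhedral complexes with integral structure); K. Kato, Toric
singularities, Amer. J. Math. 116 (1994) [Kato1994], (9.8).
-/
import Literature.Geometry.PolyhedralFans.LinkedRefinementSingle
import Literature.Geometry.PolyhedralFans.LinkedRefinementFamilyHolds
import HarnessLib

/-!
# `Fan.LinkedRegularRefinement` — the ONE-SPACE chart presentation of [KempfEtAl1973] Ch. II §2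
# Theorem 11* — is PROVED

Topic: `Literature/Geometry/PolyhedralFans` (summit `ResolutionOfSingularities`, W8.1 LINKED-KKMS).
`LinkedRefinement.lean` states KKMS II §2 Thm. 11* twice: for ONE rational fan `Δ₀ ⊆ ℚ^κ` with a
set of links (`Fan.LinkedRegularRefinement`) and for a FAMILY `Δ₀ i ⊆ ℚ^{n i}` with links
between members (`Fan.LinkedRegularRefinementFamily`). The family form is proved in
`LinkedRefinementFamilyHolds.lean` (`Fan.linkedRegularRefinementFamily_holds`: synchronised
barycentric subdivision and multiplicity descent over link orbits). `LinkedRefinementSingle.lean`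
carries the family form back to one fan by renaming the coordinates `κ ≃ Fin |κ|` and viewing the
renamed fan as a one-member family (`Fan.linkedRegularRefinement_of_linkedRegularRefinementFamily`).
Composing the two discharges the one-space named statement; nothing else is in this file.

References: [KempfEtAl1973] Ch. II §1 Def. 5, §2 Thm. 11*; [Kato1994] (9.8).
-/

noncomputable section

namespace Literature.Geometry.PolyhedralFans

/-- **[KempfEtAl1973] Ch. II §2 Theorem 11*, one-space chart presentation — PROVED**: every
rational fan `Δ₀ ⊆ ℚ^κ` with any set of links admits a refinement by lattice star subdivisions
which is regular and simplicial, carries ONE function `f ≥ 0` that is an integral tight strictly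
convex support function on every cone of `Δ₀`, and is compatible with every link and its inverse
(cones correspond, `f ∘ ℓ = f` on `ℓ.src`). Obtained from the family theorem
`Fan.linkedRegularRefinementFamily_holds` through the coordinate-renaming reduction
`Fan.linkedRegularRefinement_of_linkedRegularRefinementFamily`.
[cite: KempfEtAl1973, Ch. II §2 Thm. 11*] [cite: Kato1994, (9.8)] -/
theorem Fan.linkedRegularRefinement_holds : Fan.LinkedRegularRefinement :=
  Fan.linkedRegularRefinement_of_linkedRegularRefinementFamily
    Fan.linkedRegularRefinementFamily_holds

end Literature.Geometry.PolyhedralFans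

end
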